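import Summits.AtomisticToContinuum.Crystallization.Theorems.LoopTunnelDialForcePricingFrameRows

/-!
# LoopTunnelDial — FORCE PRICING kit 15 «FRAME», part C: the SHARP joint row inside the unit sphere; the toys replayed end to end

Companion of `LoopTunnelDialForcePricingFrameRows` (critic row 367 (4)(c)(d)).  WHY A SECOND ROW.  Part B's `rowBound` bounds `−V(s)` and
the push `c·a·h(s)·(−z₂)` SEPARATELY, each at its own worst radius of the cell.  Inside the unit sphere both are steep in `s = |z|²` with
OPPOSITE slopes (`φ′ ≈ +27`, `κ·h′ ≈ −25` at `s ≈ 0.55`, `κ = c·a·t ≈ 0.034`) and their SUM is flat — that is what the working price `c†` was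
chosen to do — so the decoupled row loses ≈ 50·Δs per point: for a cell of side 0.02 at `r ≈ 0.75` directly behind the centre the true cell
supremum of the frame weight is 0.017, `rowBound` = 0.59; side 0.05: 0.068 vs 1.21 (a = 3/4, c = 8/125; seven behind hard pushers would cost the
certificate ≈ 4 of a budget of 3.85).  No grid census could afford the radial resolution (Δs ≈ 10⁻³) that makes `rowBound` tight there.
THE JOINT ROW (§11, PROVED, no calculus): along a ray the weight is the polynomial `Pw κ w = w³/6 − w⁶/12 + κ(w⁷ − w⁴)` in `w = 1/s` (`κ = c·a·t`,
`t = −z₂`; for `s ≤ 1`, `h ≥ 0` so `t ↦` the weight is increasing and `t := (−lo₂)₊` serves the cell); the exact second-order Taylor identity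
`Pw κ w = Pw κ m + dPw κ m·(w − m) + (w − m)²·Ew κ w m` (`Ew` = the second divided difference, a polynomial with nonnegative-coefficient groups)
and the monotone-monomial bound `Ew ≤ EwU κ w_l w_u` on `[w_l, w_u]²` give, with `m` the midpoint and `Δ` the half-width of `[s_hi⁻¹, s_lo⁻¹]`,
  `rowIn c a lo hi := Pw κ m + max(dPw κ m, −dPw κ m)·Δ + Δ²·(EwU κ w_l w_u)₊`,   `frameWeight c a z ≤ rowIn c a lo hi` on boxes with `sHi ≤ 1`.
Loss is second order in the cell size: same two cells, `rowIn` = 0.024 (true 0.017) and 0.149 (true 0.068); oblique behind cell of side 0.05 at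
r ≈ 0.8: 0.186 vs 0.058; at side ≤ 0.025 the loss is ≤ 0.03 per point.  `rowSharp` = `min rowBound rowIn` inside, `rowBound` elsewhere (outside the
unit sphere all slopes are < 0.3 and `rowBound` is adequate); `rowSharp2 c a₁ a₂ := max` over the two ends of the a-box SERVES the a-box
(`rowServes_rowSharp2`), so `gridCert (rowSharp2 c a₁ a₂) g n drop` is box-valid by part B.  §12: the TOYS (d) — ONE a-box `[7/10, 3/4]`,
`R = 9/10`, grid 5³ of side 9/25 on `[−9/10, 9/10]³`, nothing dropped, singleton cliques — replayed END TO END with either row: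
`toy_finPricedLoadCap : FinPricedLoadCap (3/4) (8/125) toyCert.bound (9/10)` and `toySharp_finPricedLoadCap` (C1 grid cover → C2 row → C3 mesh →
C4/C5 → `BoxValid` → `valid_of_boxValid` → frame transport → capacity).  The budgets `toyCert.bound` are useless numbers; the point is that the
whole path ELABORATES from a table.  Census (β)/(δ): the LP and the emitted `y` MUST use `wt_i := rowSharp2 (8/125) (b j) (b (j+1)) lo_i hi_i`
exactly as defined here (rational arithmetic; `s_lo` clamped at 49/100).  0 sorry.
-/

noncomputable section

namespace Summit.AtomisticToContinuum.Crystallization.Theorems.LoopTunnelDialForcePricing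

open scoped BigOperators Classical InnerProductSpace
open Literature.MathematicalPhysics.StatisticalMechanics
open Summit.AtomisticToContinuum.Crystallization.Theorems.GrainPercolationDialCrossCeiling (E3)
open Summit.AtomisticToContinuum.Crystallization.Theorems.ChargedEnergyGapNegative (eStar)
open Summit.AtomisticToContinuum.Crystallization.Theorems.LoopTunnelDialContactLaw
open Summit.AtomisticToContinuum.Crystallization.Theorems.LoopTunnelDialRangeTails

/-! ### §11 The JOINT (V + push) second-order row for cells inside the unit sphere (PROVED) -/

/-- `Pw κ w := w³/6 − w⁶/12 + κ(w⁷ − w⁴)` — the frame weight along a ray as a polynomial in `w = 1/|z|²` at push coefficient `κ`. [line vocabulary · LoopTunnelDial contact dial · crux stmt-AtomisticToContinuum-27294 · definition, not a cited fact] -/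
def Pw (κ w : ℝ) : ℝ := w ^ 3 / 6 - w ^ 6 / 12 + κ * (w ^ 7 - w ^ 4)

/-- Its derivative in `w`, as a polynomial (no calculus is used anywhere). [line vocabulary · LoopTunnelDial contact dial · crux stmt-AtomisticToContinuum-27294 · definition, not a cited fact] -/
def dPw (κ w : ℝ) : ℝ := w ^ 2 / 2 - w ^ 5 / 2 + κ * (7 * w ^ 6 - 4 * w ^ 3)

/-- The second divided difference of `Pw` at `(w, m, m)`. [line vocabulary · LoopTunnelDial contact dial · crux stmt-AtomisticToContinuum-27294 · definition, not a cited fact] -/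
def Ew (κ w m : ℝ) : ℝ :=
  (w + 2 * m) / 6 - (w ^ 4 + 2 * (m * w ^ 3) + 3 * (m ^ 2 * w ^ 2) + 4 * (m ^ 3 * w) + 5 * m ^ 4) / 12 +
    κ * ((w ^ 5 + 2 * (m * w ^ 4) + 3 * (m ^ 2 * w ^ 3) + 4 * (m ^ 3 * w ^ 2) + 5 * (m ^ 4 * w) + 6 * m ^ 5) -
      (w ^ 2 + 2 * (m * w) + 3 * m ^ 2))

/-- The exact second-order Taylor identity (a ring identity). -/
theorem Pw_taylor (κ w m : ℝ) : Pw κ w = Pw κ m + dPw κ m * (w - m) + (w - m) ^ 2 * Ew κ w m := by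
  unfold Pw dPw Ew; ring

/-- `EwU κ w_l w_u := w_u/2 − 5w_l⁴/4 + κ(21w_u⁵ − 6w_l²)` — an upper bound of `Ew` on `[w_l, w_u]²` (`0 ≤ w_l`, `0 ≤ κ`). [line vocabulary · LoopTunnelDial contact dial · crux stmt-AtomisticToContinuum-27294 · definition, not a cited fact] -/
def EwU (κ wl wu : ℝ) : ℝ := wu / 2 - 5 * wl ^ 4 / 4 + κ * (21 * wu ^ 5 - 6 * wl ^ 2)

/-- Two-sided monomial bounds `wl^(i+j) ≤ mⁱ wʲ ≤ wu^(i+j)` on `[wl, wu]`. -/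
private theorem monomial_bounds {wl wu w m : ℝ} (hl : 0 ≤ wl) (hw : wl ≤ w) (hwu : w ≤ wu) (hm : wl ≤ m) (hmu : m ≤ wu)
    (i j : ℕ) : wl ^ (i + j) ≤ m ^ i * w ^ j ∧ m ^ i * w ^ j ≤ wu ^ (i + j) := by
  have hm0 : 0 ≤ m := hl.trans hm
  have hw0 : 0 ≤ w := hl.trans hw
  refine ⟨?_, ?_⟩ <;> rw [pow_add]
  · exact mul_le_mul (pow_le_pow_left₀ hl hm i) (pow_le_pow_left₀ hl hw j) (pow_nonneg hl _) (pow_nonneg hm0 _)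
  · exact mul_le_mul (pow_le_pow_left₀ hm0 hmu i) (pow_le_pow_left₀ hw0 hwu j) (pow_nonneg hw0 _) (pow_nonneg (hm0.trans hmu) _)

/-- `Ew κ w m ≤ EwU κ wl wu` on the box `[wl, wu]²` (`κ ≥ 0`). -/
theorem Ew_le_EwU {κ wl wu w m : ℝ} (hκ : 0 ≤ κ) (hl : 0 ≤ wl) (hw : wl ≤ w) (hwu : w ≤ wu) (hm : wl ≤ m) (hmu : m ≤ wu) :
    Ew κ w m ≤ EwU κ wl wu := by
  have B := fun i j => monomial_bounds hl hw hwu hm hmu i j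
  have q04 := (B 0 4).1; have q13 := (B 1 3).1; have q22 := (B 2 2).1; have q31 := (B 3 1).1; have q40 := (B 4 0).1
  have p05 := (B 0 5).2; have p14 := (B 1 4).2; have p23 := (B 2 3).2; have p32 := (B 3 2).2; have p41 := (B 4 1).2
  have p50 := (B 5 0).2
  have r02 := (B 0 2).1; have r11 := (B 1 1).1; have r20 := (B 2 0).1
  simp only [pow_zero, pow_one, one_mul, mul_one, Nat.zero_add, Nat.add_zero, Nat.reduceAdd] at q04 q13 q22 q31 q40 p05 p14 p23
  simp only [pow_zero, pow_one, one_mul, mul_one, Nat.zero_add, Nat.add_zero, Nat.reduceAdd] at p32 p41 p50 r02 r11 r20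
  have hquart : 15 * wl ^ 4 ≤ w ^ 4 + 2 * (m * w ^ 3) + 3 * (m ^ 2 * w ^ 2) + 4 * (m ^ 3 * w) + 5 * m ^ 4 := by linarith
  have hk : κ * ((w ^ 5 + 2 * (m * w ^ 4) + 3 * (m ^ 2 * w ^ 3) + 4 * (m ^ 3 * w ^ 2) + 5 * (m ^ 4 * w) + 6 * m ^ 5) -
      (w ^ 2 + 2 * (m * w) + 3 * m ^ 2)) ≤ κ * (21 * wu ^ 5 - 6 * wl ^ 2) :=
    mul_le_mul_of_nonneg_left (by linarith) hκ
  unfold Ew EwU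
  linarith

/-- **Second-order cell bound (PROVED):** on `w ∈ [w_l, w_u]`, with `m` the midpoint and `Δ` the half-width,
`Pw κ w ≤ Pw κ m + max(dPw κ m, −dPw κ m)·Δ + Δ²·(EwU κ w_l w_u)₊`. -/
theorem Pw_le_cell {κ wl wu w : ℝ} (hκ : 0 ≤ κ) (hl : 0 ≤ wl) (hw : wl ≤ w) (hwu : w ≤ wu) :
    Pw κ w ≤ Pw κ ((wl + wu) / 2) + max (dPw κ ((wl + wu) / 2)) (-dPw κ ((wl + wu) / 2)) * ((wu - wl) / 2) +
      ((wu - wl) / 2) ^ 2 * max (EwU κ wl wu) 0 := by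
  have hm : wl ≤ (wl + wu) / 2 := by linarith
  have hmu : (wl + wu) / 2 ≤ wu := by linarith
  have habs : |w - (wl + wu) / 2| ≤ (wu - wl) / 2 := abs_le.2 ⟨by linarith, by linarith⟩
  rw [Pw_taylor κ w ((wl + wu) / 2)]
  have h1 : dPw κ ((wl + wu) / 2) * (w - (wl + wu) / 2) ≤
      max (dPw κ ((wl + wu) / 2)) (-dPw κ ((wl + wu) / 2)) * ((wu - wl) / 2) := by
    rw [← abs_eq_max_neg]
    calc dPw κ ((wl + wu) / 2) * (w - (wl + wu) / 2) ≤ |dPw κ ((wl + wu) / 2) * (w - (wl + wu) / 2)| := le_abs_self _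
      _ = |dPw κ ((wl + wu) / 2)| * |w - (wl + wu) / 2| := abs_mul _ _
      _ ≤ |dPw κ ((wl + wu) / 2)| * ((wu - wl) / 2) := mul_le_mul_of_nonneg_left habs (abs_nonneg _)
  have h2 : (w - (wl + wu) / 2) ^ 2 * Ew κ w ((wl + wu) / 2) ≤ ((wu - wl) / 2) ^ 2 * max (EwU κ wl wu) 0 := by
    have hsq : (w - (wl + wu) / 2) ^ 2 ≤ ((wu - wl) / 2) ^ 2 := by
      rw [← sq_abs (w - (wl + wu) / 2)]; exact pow_le_pow_left₀ (abs_nonneg _) habs 2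
    calc (w - (wl + wu) / 2) ^ 2 * Ew κ w ((wl + wu) / 2) ≤ (w - (wl + wu) / 2) ^ 2 * max (EwU κ wl wu) 0 :=
          mul_le_mul_of_nonneg_left ((Ew_le_EwU hκ hl hw hwu hm hmu).trans (le_max_left _ _)) (sq_nonneg _)
      _ ≤ ((wu - wl) / 2) ^ 2 * max (EwU κ wl wu) 0 := mul_le_mul_of_nonneg_right hsq (le_max_right _ _)
  linarith

/-- Along a ray: `φ(s) + κ·h(s) = Pw κ (1/s)`. -/
theorem phi_add_mul_hfun (κ s : ℝ) : phi s + κ * hfun s = Pw κ s⁻¹ := by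
  unfold phi hfun Pw; ring

/-- Inside the unit sphere the force factor is nonnegative: `h(s) ≥ 0` for `0 < s ≤ 1`. -/
theorem hfun_nonneg_of_le_one {s : ℝ} (hs : 0 < s) (h1 : s ≤ 1) : 0 ≤ hfun s := by
  have hw : 1 ≤ s⁻¹ := (one_le_inv₀ hs).2 h1
  have h47 : s⁻¹ ^ 4 ≤ s⁻¹ ^ 7 := pow_le_pow_right₀ hw (by norm_num)
  unfold hfun; linarith

/-- **`rowIn c a lo hi` — THE JOINT ROW** for boxes inside the unit sphere: `w_l := sHi⁻¹`, `w_u := (max sLo 49/100)⁻¹`, `κ := c·a·(−lo₂)₊`,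
midpoint/half-width second-order bound of `Pw κ` on `[w_l, w_u]`. [line vocabulary · LoopTunnelDial contact dial · crux stmt-AtomisticToContinuum-27294 · definition, not a cited fact] -/
def rowIn (c a : ℝ) (lo hi : Fin 3 → ℝ) : ℝ :=
  Pw (c * a * max (-lo 2) 0) (((sHi lo hi)⁻¹ + (max (sLo lo hi) (49 / 100))⁻¹) / 2) +
    max (dPw (c * a * max (-lo 2) 0) (((sHi lo hi)⁻¹ + (max (sLo lo hi) (49 / 100))⁻¹) / 2))
      (-dPw (c * a * max (-lo 2) 0) (((sHi lo hi)⁻¹ + (max (sLo lo hi) (49 / 100))⁻¹) / 2)) *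
      (((max (sLo lo hi) (49 / 100))⁻¹ - (sHi lo hi)⁻¹) / 2) +
    (((max (sLo lo hi) (49 / 100))⁻¹ - (sHi lo hi)⁻¹) / 2) ^ 2 *
      max (EwU (c * a * max (-lo 2) 0) (sHi lo hi)⁻¹ (max (sLo lo hi) (49 / 100))⁻¹) 0

/-- **THE JOINT ROW IS SOUND (PROVED):** `frameWeight c a z ≤ rowIn c a lo hi` for `z` in a box with `sHi ≤ 1`, `|z| ≥ 7/10` (`c, a ≥ 0`). -/
theorem frameWeight_le_rowIn {c a : ℝ} (hc : 0 ≤ c) (ha : 0 ≤ a) {lo hi : Fin 3 → ℝ} {z : E3}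
    (hz : z ∈ box lo hi) (h7 : (7 : ℝ) / 10 ≤ ‖z‖) (hin : sHi lo hi ≤ 1) : frameWeight c a z ≤ rowIn c a lo hi := by
  have hsl : 0 < max (sLo lo hi) (49 / 100) := lt_max_of_lt_right (by norm_num)
  have h1 : max (sLo lo hi) (49 / 100) ≤ ‖z‖ ^ 2 := max_le (sLo_le_norm_sq hz) (by nlinarith)
  have h2 : ‖z‖ ^ 2 ≤ sHi lo hi := norm_sq_le_sHi hz
  have hs : 0 < ‖z‖ ^ 2 := lt_of_lt_of_le hsl h1
  have hsu : 0 < sHi lo hi := lt_of_lt_of_le hs h2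
  have hκ : 0 ≤ c * a * max (-lo 2) 0 := mul_nonneg (mul_nonneg hc ha) (le_max_right _ _)
  have hf0 : 0 ≤ hfun (‖z‖ ^ 2) := hfun_nonneg_of_le_one hs (h2.trans hin)
  have ht : -(z 2) ≤ max (-lo 2) 0 := by linarith [(hz 2).1, le_max_left (-lo 2) 0]
  have step1 : frameWeight c a z ≤ phi (‖z‖ ^ 2) + c * a * max (-lo 2) 0 * hfun (‖z‖ ^ 2) := by
    rw [frameWeight_eq]
    have : -(hfun (‖z‖ ^ 2) * z 2) ≤ hfun (‖z‖ ^ 2) * max (-lo 2) 0 := by nlinarith [mul_le_mul_of_nonneg_left ht hf0]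
    nlinarith [mul_le_mul_of_nonneg_left this (mul_nonneg hc ha)]
  rw [phi_add_mul_hfun] at step1
  exact step1.trans (Pw_le_cell hκ (inv_nonneg.2 hsu.le) (inv_anti₀ hs h2) (inv_anti₀ hsl h1))

/-- **`rowSharp c a lo hi`** — the joint row where it applies (`sHi ≤ 1`, then the better of the two), `rowBound` elsewhere. [line vocabulary · LoopTunnelDial contact dial · crux stmt-AtomisticToContinuum-27294 · definition, not a cited fact] -/
def rowSharp (c a : ℝ) (lo hi : Fin 3 → ℝ) : ℝ :=
  if sHi lo hi ≤ 1 then min (rowBound c a lo hi) (rowIn c a lo hi) else rowBound c a lo hi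

/-- The frame weight on a box outside the `7/10`-ball is bounded by `rowSharp`. -/
theorem frameWeight_le_rowSharp {c a : ℝ} (hc : 0 ≤ c) (ha : 0 ≤ a) {lo hi : Fin 3 → ℝ} {z : E3}
    (hz : z ∈ box lo hi) (h7 : (7 : ℝ) / 10 ≤ ‖z‖) : frameWeight c a z ≤ rowSharp c a lo hi := by
  unfold rowSharp
  split_ifs with hin
  · exact le_min (frameWeight_le_rowBound hc ha hz h7) (frameWeight_le_rowIn hc ha hz h7 hin)
  · exact frameWeight_le_rowBound hc ha hz h7

/-- **`rowSharp2 c a₁ a₂ lo hi := max (rowSharp c a₁ lo hi) (rowSharp c a₂ lo hi)`** — the row of record for the a-box `[a₁, a₂]` (the frame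
weight is affine in `a`, so the two ends suffice; no monotonicity in `a` is needed). [line vocabulary · LoopTunnelDial contact dial · crux stmt-AtomisticToContinuum-27294 · definition, not a cited fact] -/
def rowSharp2 (c a₁ a₂ : ℝ) (lo hi : Fin 3 → ℝ) : ℝ := max (rowSharp c a₁ lo hi) (rowSharp c a₂ lo hi)

/-- The sharp row SERVES the a-box (`0 ≤ c`, `0 ≤ a₁ ≤ a₂`): plug it into `gridCert` / `gridCert_boxValid` of part B. -/
theorem rowServes_rowSharp2 {c a₁ a₂ : ℝ} (hc : 0 ≤ c) (ha₁ : 0 ≤ a₁) (h12 : a₁ ≤ a₂) : RowServes c a₁ a₂ (rowSharp2 c a₁ a₂) :=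
  fun _ _ _ hz h7 => ⟨(frameWeight_le_rowSharp hc ha₁ hz h7).trans (le_max_left _ _),
    (frameWeight_le_rowSharp hc (ha₁.trans h12) hz h7).trans (le_max_right _ _)⟩

/-! ### §12 (d) The TOYS replayed end to end (PROVED) -/

/-- The toy grid: per axis the breakpoints `−9/10 + (9/25)·j`, `j = 0, …, 5` (side `9/25`, extent `[−9/10, 9/10]`). [line vocabulary · LoopTunnelDial contact dial · crux stmt-AtomisticToContinuum-27294 · definition, not a cited fact] -/
def toyG : Fin 3 → ℕ → ℝ := fun _ j => -(9 / 10) + 9 / 25 * j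

/-- Five intervals per axis. [line vocabulary · LoopTunnelDial contact dial · crux stmt-AtomisticToContinuum-27294 · definition, not a cited fact] -/
def toyN : Fin 3 → ℕ := fun _ => 5

/-- The toy grid starts at or below `-R` (`R ≤ 9/10`). -/
theorem toyG_lo (R : ℝ) (hR : R ≤ 9 / 10) (k : Fin 3) : toyG k 0 ≤ -R := by simp [toyG]; linarith

/-- The toy grid ends at or above `R` (`R ≤ 9/10`). -/
theorem toyG_hi (R : ℝ) (hR : R ≤ 9 / 10) (k : Fin 3) : R ≤ toyG k (toyN k) := by norm_num [toyG, toyN]; linarith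

/-- Every toy cell has squared diameter `< 49/100`. -/
theorem toy_mesh (j : Fin 3 → ℕ) :
    (gridHi toyG j 0 - gridLo toyG j 0) ^ 2 + (gridHi toyG j 1 - gridLo toyG j 1) ^ 2 + (gridHi toyG j 2 - gridLo toyG j 2) ^ 2 < 49 / 100 := by
  have hd : ∀ k, gridHi toyG j k - gridLo toyG j k = 9 / 25 := fun k => by
    simp only [gridHi, gridLo, toyG]; push_cast; ring
  rw [hd, hd, hd]; norm_num

/-- The toy certificate with the simple row: `c = 8/125`, a-box upper end `3/4`, nothing dropped. [line vocabulary · LoopTunnelDial contact dial · crux stmt-AtomisticToContinuum-27294 · definition, not a cited fact] -/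
def toyCert : CellCert := gridCert (rowBound (8 / 125) (3 / 4)) toyG toyN fun _ => False

/-- The toy certificate is box-valid on the a-box `[7/10, 3/4]` at range `9/10`. -/
theorem toyCert_boxValid : toyCert.BoxValid (8 / 125) (7 / 10) (3 / 4) (9 / 10) :=
  gridCert_boxValid (by norm_num) (rowServes_rowBound (by norm_num) (by norm_num) (by norm_num)) (fun _ => by norm_num [toyN])
    (toyG_lo _ le_rfl) (toyG_hi _ le_rfl) (fun j _ => toy_mesh j) (fun _ _ h => h.elim)

/-- **THE TOY REPLAYED END TO END (PROVED):** `FinPricedLoadCap (3/4) (8/125) Λ_toy (9/10)` from ONE a-box `[7/10, 3/4]` and the censored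
grid certificate, through `finPricedLoadCap_of_boxCerts` (C1–C5 → a-box → frame transport → capacity).  `Λ_toy = toyCert.bound`. -/
theorem toy_finPricedLoadCap : FinPricedLoadCap (3 / 4) (8 / 125) toyCert.bound (9 / 10) :=
  finPricedLoadCap_of_boxCerts (fun j => if j = 0 then 7 / 10 else 3 / 4) 1 one_pos (by norm_num) (by norm_num)
    fun j hj => by
      obtain rfl : j = 0 := by omega
      exact ⟨toyCert, by simpa using toyCert_boxValid, le_rfl⟩

/-- The same toy with the SHARP row of record. [line vocabulary · LoopTunnelDial contact dial · crux stmt-AtomisticToContinuum-27294 · definition, not a cited fact] -/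
def toyCertSharp : CellCert := gridCert (rowSharp2 (8 / 125) (7 / 10) (3 / 4)) toyG toyN fun _ => False

/-- The toy sharp certificate is box-valid at `(8/125, 7/10, 3/4, 9/10)`. -/
theorem toyCertSharp_boxValid : toyCertSharp.BoxValid (8 / 125) (7 / 10) (3 / 4) (9 / 10) :=
  gridCert_boxValid (by norm_num) (rowServes_rowSharp2 (by norm_num) (by norm_num) (by norm_num)) (fun _ => by norm_num [toyN])
    (toyG_lo _ le_rfl) (toyG_hi _ le_rfl) (fun j _ => toy_mesh j) (fun _ _ h => h.elim)

/-- **THE SHARP TOY REPLAYED END TO END (PROVED).** -/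
theorem toySharp_finPricedLoadCap : FinPricedLoadCap (3 / 4) (8 / 125) toyCertSharp.bound (9 / 10) :=
  finPricedLoadCap_of_boxCerts (fun j => if j = 0 then 7 / 10 else 3 / 4) 1 one_pos (by norm_num) (by norm_num)
    fun j hj => by
      obtain rfl : j = 0 := by omega
      exact ⟨toyCertSharp, by simpa using toyCertSharp_boxValid, le_rfl⟩

end Summit.AtomisticToContinuum.Crystallization.Theorems.LoopTunnelDialForcePricing

end
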